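import Mathlib

/-!
# The truncated von Mangoldt split on squarefree integers

Solo-blind programme on `Parity/BatemanHorn`, §8.5 of the write-up (the "anti-diagonal"
threshold).  Let `Λ_R(n) = ∑_{d ∣ n, d ≤ R} μ(d) log(R/d)` be the truncated von Mangoldt weight
(Selberg; Goldston–Yıldırım).  For every squarefree `n > 1` and every real `R > 0` one has the
exact identity

  `Λ(n) = Λ_R(n) − μ(n) · Λ_{n/R}(n)`

(stated below with the truncated weights written out as explicit divisor sums).

Proof: `∑_{d ∣ n} μ(d) log(R/d) = Λ(n)` for `n > 1`; split the divisor sum at `d = R` and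
re-index the upper part by `d ↦ n/d`, using `μ(n) μ(n/d) = μ(d)` for squarefree `n`.

Consequence (not formalised here): a sequence with level of distribution `x^ν` for the plain
counts and level `x^α` for the Möbius/Liouville-twisted counts, `ν + α > 1`, satisfies the prime
asymptotic on its squarefree support — the "known" half `C⁻ = C⁺ = 1` above the anti-diagonal,
with a two-line proof; in the large-`q` function-field model the same identity explains the
observed LP threshold `deg_plain + deg_twisted ≥ n − 2`.
-/

namespace Summit.Parity.BatemanHorn.Theorems

open ArithmeticFunction Finset
open scoped ArithmeticFunction.Moebius ArithmeticFunction.zeta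

/-- For `n ≠ 1` and `R ≠ 0`: `∑_{d ∣ n} μ(d) log(R/d) = Λ(n)` (the `log R` part vanishes,
the `log d` part is `-∑ μ(d) log d = Λ(n)`). -/
theorem sum_moebius_mul_log_div_eq_vonMangoldt {n : ℕ} (hn : n ≠ 1) {R : ℝ} (hR : R ≠ 0) :
    ∑ d ∈ n.divisors, (μ d : ℝ) * Real.log (R / d) = Λ n := by
  rcases Nat.eq_zero_or_pos n with rfl | hpos
  · simp
  have hsplit : ∀ d ∈ n.divisors,
      (μ d : ℝ) * Real.log (R / d) = (μ d : ℝ) * Real.log R - (μ d : ℝ) * Real.log d := by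
    intro d hd
    have hd0 : (d : ℝ) ≠ 0 := by
      have := Nat.pos_of_mem_divisors hd
      exact_mod_cast this.ne'
    rw [Real.log_div hR hd0]; ring
  have hlog : ∑ d ∈ n.divisors, (μ d : ℝ) * Real.log d = -Λ n := by
    have := @sum_moebius_mul_log_eq n
    simpa only [ArithmeticFunction.log_apply] using this
  rw [sum_congr rfl hsplit, sum_sub_distrib, ← sum_mul, hlog]
  have hμ : ∑ d ∈ n.divisors, (μ d : ℝ) = 0 := by
    have h1 : (∑ d ∈ n.divisors, μ d : ℤ) = 0 := by
      have := congrArg (fun f : ArithmeticFunction ℤ => f n) moebius_mul_coe_zeta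
      simp only [coe_mul_zeta_apply, one_apply_ne hn] at this
      exact this
    exact_mod_cast h1
  rw [hμ]; ring

/-- For squarefree `n` and `d ∣ n`: `μ(n) · μ(n/d) = μ(d)`. -/
theorem moebius_mul_moebius_div_of_squarefree {n d : ℕ} (hn : Squarefree n) (hd : d ∣ n) :
    (μ n : ℤ) * μ (n / d) = μ d := by
  obtain ⟨e, rfl⟩ := hd
  have hd0 : d ≠ 0 := by rintro rfl; simp at hn
  rw [Nat.mul_div_cancel_left e (Nat.pos_of_ne_zero hd0)]
  have h := Nat.squarefree_mul_iff.mp hn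
  rw [isMultiplicative_moebius.map_mul_of_coprime h.1, mul_assoc, ← sq,
    moebius_sq_eq_one_of_squarefree h.2.2, mul_one]

/-- Pointwise bookkeeping for the split at `d = R`: for `d, R > 0`,
`[d ≤ R] log(R/d) − [R ≤ d] log(d/R) = log(R/d)`. -/
theorem ite_log_split {d R : ℝ} (hd : 0 < d) (hR : 0 < R) :
    ((if d ≤ R then Real.log (R / d) else 0) - if R ≤ d then Real.log (d / R) else 0)
      = Real.log (R / d) := by
  have h1 : Real.log (d / R) = -Real.log (R / d) := by
    rw [Real.log_div hd.ne' hR.ne', Real.log_div hR.ne' hd.ne']; ring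
  by_cases hdR : d ≤ R
  · by_cases hRd : R ≤ d
    · have : d = R := le_antisymm hdR hRd
      subst this
      simp [div_self hd.ne']
    · simp [hdR, hRd]
  · have hRd : R ≤ d := le_of_lt (lt_of_not_ge hdR)
    simp [hdR, hRd, h1]

/-- **The split identity.**  For squarefree `n ≠ 1` and real `R > 0`:
`Λ(n) = Λ_R(n) − μ(n) · Λ_{n/R}(n)`, where `Λ_R(n) = ∑_{d ∣ n, d ≤ R} μ(d) log(R/d)` is the
truncated von Mangoldt weight (written out as explicit divisor sums). -/
theorem vonMangoldt_eq_trunc_sub_moebius_mul_trunc {n : ℕ} (hn : Squarefree n) (hn1 : n ≠ 1)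
    {R : ℝ} (hR : 0 < R) :
    (Λ n : ℝ) = (∑ d ∈ n.divisors, if (d : ℝ) ≤ R then (μ d : ℝ) * Real.log (R / d) else 0)
      - (μ n : ℝ) *
        ∑ d ∈ n.divisors, if (d : ℝ) ≤ n / R then (μ d : ℝ) * Real.log (n / R / d) else 0 := by
  have hn0 : n ≠ 0 := hn.ne_zero
  have hnpos : (0 : ℝ) < n := by exact_mod_cast Nat.pos_of_ne_zero hn0
  -- re-index the second truncated sum by `d ↦ n / d`
  have hreindex :
      (∑ d ∈ n.divisors, if (d : ℝ) ≤ n / R then (μ d : ℝ) * Real.log (n / R / d) else 0) =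
      ∑ d ∈ n.divisors, if R ≤ (d : ℝ) then (μ (n / d) : ℝ) * Real.log (d / R) else 0 := by
    rw [← Nat.sum_div_divisors n
      (fun e => if (e : ℝ) ≤ n / R then (μ e : ℝ) * Real.log (n / R / e) else 0)]
    apply sum_congr rfl
    intro d hd
    have hdn : d ∣ n := Nat.dvd_of_mem_divisors hd
    have hdpos : 0 < d := Nat.pos_of_mem_divisors hd
    have hd0 : (d : ℝ) ≠ 0 := by exact_mod_cast hdpos.ne'
    have hcast : ((n / d : ℕ) : ℝ) = (n : ℝ) / d := Nat.cast_div hdn hd0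
    have hiff : ((n : ℝ) / d ≤ n / R) ↔ R ≤ (d : ℝ) := by
      rw [div_le_div_iff_of_pos_left hnpos (by exact_mod_cast hdpos) hR]
    have hlog : Real.log ((n : ℝ) / R / ((n : ℝ) / d)) = Real.log (d / R) := by
      congr 1; field_simp
    simp only [hcast, hlog]
    by_cases h : R ≤ (d : ℝ)
    · rw [if_pos (hiff.mpr h), if_pos h]
    · rw [if_neg (fun h' => h (hiff.mp h')), if_neg h]
  rw [hreindex, ← sum_moebius_mul_log_div_eq_vonMangoldt hn1 hR.ne', mul_sum, ← sum_sub_distrib]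
  apply sum_congr rfl
  intro d hd
  have hdn : d ∣ n := Nat.dvd_of_mem_divisors hd
  have hdpos : (0 : ℝ) < d := by exact_mod_cast Nat.pos_of_mem_divisors hd
  have hμ : (μ n : ℝ) * (μ (n / d) : ℝ) = μ d := by
    exact_mod_cast moebius_mul_moebius_div_of_squarefree hn hdn
  have key := ite_log_split hdpos hR
  -- massage: μ n * (if R ≤ d then μ(n/d) log(d/R) else 0) = if R ≤ d then μ d log(d/R) else 0
  have h2 : (μ n : ℝ) * (if R ≤ (d : ℝ) then (μ (n / d) : ℝ) * Real.log (d / R) else 0)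
      = (μ d : ℝ) * (if R ≤ (d : ℝ) then Real.log (d / R) else 0) := by
    split_ifs <;> simp [← hμ, mul_assoc]
  have h1 : (if (d : ℝ) ≤ R then (μ d : ℝ) * Real.log (R / d) else 0)
      = (μ d : ℝ) * (if (d : ℝ) ≤ R then Real.log (R / d) else 0) := by
    split_ifs <;> simp
  rw [h1, h2, ← mul_sub, key]

/-- The same identity with the second level written as `Q`, `R * Q = n`:
`Λ(n) = Λ_R(n) − μ(n) Λ_Q(n)` (squarefree `n ≠ 1`, `R > 0`). -/
theorem vonMangoldt_eq_trunc_sub_moebius_mul_trunc' {n : ℕ} (hn : Squarefree n) (hn1 : n ≠ 1)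
    {R Q : ℝ} (hR : 0 < R) (hRQ : R * Q = n) :
    (Λ n : ℝ) = (∑ d ∈ n.divisors, if (d : ℝ) ≤ R then (μ d : ℝ) * Real.log (R / d) else 0)
      - (μ n : ℝ) * ∑ d ∈ n.divisors, if (d : ℝ) ≤ Q then (μ d : ℝ) * Real.log (Q / d) else 0 := by
  have hQ : Q = n / R := by rw [← hRQ]; field_simp
  rw [hQ]; exact vonMangoldt_eq_trunc_sub_moebius_mul_trunc hn hn1 hR

end Summit.Parity.BatemanHorn.Theorems
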